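import Literature.MathematicalPhysics.KineticTheory.SiteChainLaSalle
import HarnessLib

/-!
# Frictionless site-inhomogeneous chains: the Hamiltonian flow through a truncated field

Topic `Literature/MathematicalPhysics/KineticTheory`, grouping namespace `…KineticTheory.HeatConduction`.
Deterministic toolbox for the HIGH-ENERGY LIMIT SYSTEMS of Cuneo–Eckmann–Hairer–Rey-Bellet
(EJP 23 (2018) no. 55, §5.1 eq. (5.10): `dq̂ = p̂ dσ`, `dp̂ = -∇Ĥ dσ`, no friction, no noise) when the
limit chain is a SITE-DEPENDENT chain `P : SiteChain` (`CellChain.lean`) with `P.γ = 0`, i.e. the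
Hamiltonian vector field `Y = P.langevinDrift N = (p, -∇_q H)` of `SiteChainConfined.lean`.
Sitewise twin of the flow half of `LangevinChainScalingLimit.lean` / `LangevinChainLimitFlow.lean`
(which treat the homogeneous `OscillatorChain`):

* `SiteChain.hamiltonian_eq_of_hasDerivAt_langevinDrift` — **energy conservation along every
  classical solution** of `y' = Y(y)` on an open interval, up to the endpoints by continuity;
* `isIntegralSolutionOn_of_hasDerivAt_Ioo` — a classical solution on `(0, T)`, continuous on
  `[0, T]`, solves the integral equation `y(t) = y(0) + ∫₀ᵗ Y(y)` (FTC);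
* the TRUNCATED HAMILTONIAN FLOW `drivenTruncSol (P.langevinDrift N) R x 0` (the Picard solution of
  the globally Lipschitz field `Y_R = χ_R Y`, `ConfinedForcedFlow.lean`, with the zero noise path):
  clamped at `x` on `(-∞, 0]`, integral equation, one- and two-sided derivatives, **exact energy
  conservation** (`hamiltonian_truncFlow`: `Y_R` is a scalar multiple of `Y` and `DH·Y = 0`),
  **joint continuity in `(x, t)`** (`continuous_truncFlow_uncurry`: Grönwall in `x`, uniformly on
  time strips) and continuity of the parametric integrals `x ↦ ∫ₐᵇ φ(ψ_x(s)) ds`;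
* under a radius hypothesis `H ≤ h₀ ⟹ ‖·‖ ≤ R` the truncation is invisible from data with
  `H(x) ≤ h₀` (`truncateField_truncFlow`): the truncated flow solves `y' = Y(y)`
  (`hasDerivAt_truncFlow_langevinDrift`), and **every** continuous classical solution on `(0, T)`
  started at `x` coincides with it on `[0, T]` (`eqOn_truncFlow_of_hasDerivAt`, uniqueness).

## References

* N. Cuneo, J.-P. Eckmann, M. Hairer, L. Rey-Bellet, *Non-equilibrium steady states for networks of
  oscillators*, Electron. J. Probab. **23** (2018) no. 55, §5.1 eq. (5.10), Prop. 5.14.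
* E. A. Coddington, N. Levinson, *Theory of Ordinary Differential Equations* (1955), Ch. 1 (Picard,
  Grönwall), through `Literature/Analysis/ODE/PicardForcing.lean`.

## Design choices

* No new definition: the flow is `drivenTruncSol (P.langevinDrift N) R x 0` of
  `ConfinedForcedFlow.lean`; the radius enters through the hypothesis
  `hρ : ∀ z, P.hamiltonian N z ≤ h₀ → ‖z‖ ≤ R`, supplied by the model (e.g. quartic chains).
* Hypotheses are sitewise (`∀ i, ContDiff ℝ 2 (P.U i)`), no `UniformlyConfining` (the limit chains
  of CEHR have unpinned sites).
-/

noncomputable section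

open MeasureTheory Filter Topology Set Metric
open scoped NNReal

namespace Literature.MathematicalPhysics.KineticTheory.HeatConduction

open Literature.MathematicalPhysics.KineticTheory Literature.Analysis.ODE

variable {N : ℕ}

/-- **FTC for classical solutions**: a continuous path with `y' = F(y)` on `(0, T)` (`F`
continuous) solves the integral equation `y(t) = y(0) + ∫₀ᵗ F(y(s)) ds` on `[0, T]`. [folklore] -/
theorem isIntegralSolutionOn_of_hasDerivAt_Ioo {E : Type*} [NormedAddCommGroup E] [NormedSpace ℝ E]
    [CompleteSpace E] {F : E → E} (hF : Continuous F) {y : ℝ → E} (hyc : Continuous y) {T : ℝ}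
    (hy : ∀ t ∈ Ioo 0 T, HasDerivAt y (F (y t)) t) :
    IsIntegralSolutionOn F (fun _ => y 0) y T := by
  intro t ht
  have h := intervalIntegral.integral_eq_sub_of_hasDerivAt_of_le ht.1 hyc.continuousOn
    (fun s hs => hy s ⟨hs.1, hs.2.trans_le ht.2⟩) ((hF.comp hyc).intervalIntegrable 0 t)
  rw [h]
  abel

namespace SiteChain

variable (P : SiteChain)

/-! ### Energy conservation along classical solutions of the frictionless chain -/

/-- **Energy conservation along every classical solution** of the frictionless chain
(`P.γ = 0`, `C¹` potentials): if `y` is continuous on `[a, b]` and `y' = Y(y)` on `(a, b)` then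
`H(y(t)) = H(y(a))` on `[a, b]` (`DH·Y = 0`, mean value theorem, continuity at the endpoints).
[cite: CuneoEckmannHairerReyBellet2018, §5.1 (proof of Lemma 5.17)] -/
theorem hamiltonian_eq_of_hasDerivAt_langevinDrift (hU : ∀ i, ContDiff ℝ 1 (P.U i))
    (hV : ∀ i, ContDiff ℝ 1 (P.V i)) (hγ : P.γ = 0) {y : ℝ → PhaseSpace N} {a b : ℝ}
    (hyc : ContinuousOn y (Icc a b)) (hy : ∀ t ∈ Ioo a b, HasDerivAt y (P.langevinDrift N (y t)) t) :
    ∀ t ∈ Icc a b, P.hamiltonian N (y t) = P.hamiltonian N (y a) := by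
  have hH : Differentiable ℝ (P.hamiltonian N) :=
    (P.contDiff_hamiltonian N hU hV).differentiable one_ne_zero
  have hd : ∀ t ∈ Ioo a b, HasDerivAt (fun s => P.hamiltonian N (y s)) 0 t := by
    intro t ht
    have h := (hH (y t)).hasFDerivAt.comp_hasDerivAt t (hy t ht)
    rw [P.fderiv_hamiltonian_freeDrift hU hV, hγ, zero_mul, neg_zero] at h
    exact h
  intro t ht
  rcases eq_or_lt_of_le ht.1 with h | h
  · rw [h]
  · obtain ⟨c, -, hc⟩ := exists_hasDerivAt_eq_slope (fun s => P.hamiltonian N (y s)) (fun _ => (0 : ℝ))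
      h (hH.continuous.comp_continuousOn (hyc.mono (Icc_subset_Icc_right ht.2)))
      (fun s hs => hd s ⟨hs.1, hs.2.trans_le ht.2⟩)
    have hne : t - a ≠ 0 := sub_ne_zero.2 h.ne'
    rcases (div_eq_zero_iff.1 hc.symm) with h1 | h1
    · linarith
    · exact absurd h1 hne

/-! ### The truncated Hamiltonian flow: basic properties -/

/-- The truncated Langevin drift `Y_R = χ_R Y` of a chain with `C²` potentials is globally
Lipschitz (some constant). [folklore] -/
theorem exists_lipschitzWith_truncateField_langevinDrift (hU : ∀ i, ContDiff ℝ 2 (P.U i))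
    (hV : ∀ i, ContDiff ℝ 2 (P.V i)) (N : ℕ) {R : ℝ} (hR : 0 < R) :
    ∃ K : ℝ≥0, LipschitzWith K (truncateField R (P.langevinDrift N)) :=
  exists_lipschitzWith_truncateField (P.contDiff_one_langevinDrift hU hV N) hR

/-- The constant forcing `t ↦ x + 0(t)` of the noiseless equation is continuous. [folklore] -/
theorem continuous_forcing_zero (x : PhaseSpace N) :
    Continuous fun t : ℝ => x + (0 : ℝ → PhaseSpace N) t :=
  continuous_const.add continuous_zero

section TruncFlow

variable {P} (hU : ∀ i, ContDiff ℝ 2 (P.U i)) (hV : ∀ i, ContDiff ℝ 2 (P.V i)) (N : ℕ) {R : ℝ}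
  (hR : 0 < R)
include hU hV hR

/-- The truncated Hamiltonian flow is continuous in time. [folklore] -/
theorem continuous_truncFlow (x : PhaseSpace N) :
    Continuous (drivenTruncSol (P.langevinDrift N) R x 0) := by
  obtain ⟨K, hK⟩ := P.exists_lipschitzWith_truncateField_langevinDrift hU hV N hR
  exact continuous_forcedSolution hK (continuous_forcing_zero x)

/-- **The truncated integral equation**: `ψ(t) = x + ∫₀ᵗ Y_R(ψ(s)) ds` for `t ≥ 0`. [folklore] -/
theorem truncFlow_eq_add_integral (x : PhaseSpace N) {t : ℝ} (ht : 0 ≤ t) :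
    drivenTruncSol (P.langevinDrift N) R x 0 t =
      x + ∫ s in (0 : ℝ)..t,
        truncateField R (P.langevinDrift N) (drivenTruncSol (P.langevinDrift N) R x 0 s) := by
  obtain ⟨K, hK⟩ := P.exists_lipschitzWith_truncateField_langevinDrift hU hV N hR
  have h := forcedSolution_eq hK (continuous_forcing_zero x) ht
  unfold drivenTruncSol
  rw [h]
  simp

/-- For `t ≤ 0` the truncated flow is clamped at `x`. [folklore] -/
theorem truncFlow_of_nonpos (x : PhaseSpace N) {t : ℝ} (ht : t ≤ 0) :
    drivenTruncSol (P.langevinDrift N) R x 0 t = x := by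
  obtain ⟨K, hK⟩ := P.exists_lipschitzWith_truncateField_langevinDrift hU hV N hR
  unfold drivenTruncSol
  rw [forcedSolution_of_nonpos _ _ ht, forcedSolution_zero hK (continuous_forcing_zero x)]
  simp

/-- `ψ(0) = x`. [folklore] -/
theorem truncFlow_zero (x : PhaseSpace N) : drivenTruncSol (P.langevinDrift N) R x 0 0 = x :=
  truncFlow_of_nonpos hU hV N hR x le_rfl

/-- The everywhere-differentiable primitive `t ↦ x + ∫₀ᵗ Y_R(ψ(s)) ds` has derivative `Y_R(ψ(t))`.
[folklore] -/
theorem hasDerivAt_add_integral_truncFlow (x : PhaseSpace N) (t : ℝ) :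
    HasDerivAt (fun s => x + ∫ r in (0 : ℝ)..s,
        truncateField R (P.langevinDrift N) (drivenTruncSol (P.langevinDrift N) R x 0 r))
      (truncateField R (P.langevinDrift N) (drivenTruncSol (P.langevinDrift N) R x 0 t)) t := by
  obtain ⟨K, hK⟩ := P.exists_lipschitzWith_truncateField_langevinDrift hU hV N hR
  have hc : Continuous fun s =>
      truncateField R (P.langevinDrift N) (drivenTruncSol (P.langevinDrift N) R x 0 s) :=
    hK.continuous.comp (continuous_truncFlow hU hV N hR x)
  exact (hc.integral_hasStrictDerivAt 0 t).hasDerivAt.const_add x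

/-- **Right derivative of the truncated flow** on `[0, ∞)`: `ψ'(t⁺) = Y_R(ψ(t))`. [folklore] -/
theorem hasDerivWithinAt_truncFlow (x : PhaseSpace N) {t : ℝ} (ht : 0 ≤ t) :
    HasDerivWithinAt (drivenTruncSol (P.langevinDrift N) R x 0)
      (truncateField R (P.langevinDrift N) (drivenTruncSol (P.langevinDrift N) R x 0 t)) (Ici t) t := by
  refine ((hasDerivAt_add_integral_truncFlow hU hV N hR x t).hasDerivWithinAt (s := Ici t)).congr
    (fun s hs => ?_) ?_
  · exact truncFlow_eq_add_integral hU hV N hR x (ht.trans hs)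
  · exact truncFlow_eq_add_integral hU hV N hR x ht

/-- **Derivative of the truncated flow** on `(0, ∞)`: `ψ'(t) = Y_R(ψ(t))`. [folklore] -/
theorem hasDerivAt_truncFlow (x : PhaseSpace N) {t : ℝ} (ht : 0 < t) :
    HasDerivAt (drivenTruncSol (P.langevinDrift N) R x 0)
      (truncateField R (P.langevinDrift N) (drivenTruncSol (P.langevinDrift N) R x 0 t)) t := by
  refine (hasDerivAt_add_integral_truncFlow hU hV N hR x t).congr_of_eventuallyEq ?_
  filter_upwards [Ioi_mem_nhds ht] with s hs
  exact truncFlow_eq_add_integral hU hV N hR x (le_of_lt hs)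

/-- **Exact energy conservation along the truncated flow** of a frictionless chain (`P.γ = 0`):
`H(ψ_x(t)) = H(x)` for all `t` (`Y_R = χ_R Y` and `DH·Y = 0`). [folklore] -/
theorem hamiltonian_truncFlow (hγ : P.γ = 0) (x : PhaseSpace N) (t : ℝ) :
    P.hamiltonian N (drivenTruncSol (P.langevinDrift N) R x 0 t) = P.hamiltonian N x := by
  rcases le_or_gt t 0 with ht | ht
  · rw [truncFlow_of_nonpos hU hV N hR x ht]
  · have hU1 : ∀ i, ContDiff ℝ 1 (P.U i) := fun i => (hU i).of_le (by norm_num)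
    have hV1 : ∀ i, ContDiff ℝ 1 (P.V i) := fun i => (hV i).of_le (by norm_num)
    have hH : Differentiable ℝ (P.hamiltonian N) :=
      (P.contDiff_hamiltonian N hU1 hV1).differentiable one_ne_zero
    set z := drivenTruncSol (P.langevinDrift N) R x 0 with hz
    set g : ℝ → PhaseSpace N := fun s => x + ∫ r in (0 : ℝ)..s,
      truncateField R (P.langevinDrift N) (z r) with hg
    have hgz : ∀ s, 0 ≤ s → g s = z s := fun s hs => (truncFlow_eq_add_integral hU hV N hR x hs).symm
    have hd : ∀ s, 0 ≤ s → HasDerivAt (fun r => P.hamiltonian N (g r)) 0 s := by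
      intro s hs
      have h := (hH (g s)).hasFDerivAt.comp_hasDerivAt s (hasDerivAt_add_integral_truncFlow hU hV N hR x s)
      have h0 : fderiv ℝ (P.hamiltonian N) (g s) (truncateField R (P.langevinDrift N) (z s)) = 0 := by
        rw [truncateField, map_smul, hgz s hs, P.fderiv_hamiltonian_freeDrift hU1 hV1, hγ]
        simp
      rw [h0] at h
      exact h
    have hcont : Continuous fun r => P.hamiltonian N (g r) :=
      hH.continuous.comp (continuous_iff_continuousAt.2 fun s =>
        (hasDerivAt_add_integral_truncFlow hU hV N hR x s).continuousAt)
    have h := constant_of_has_deriv_right_zero hcont.continuousOn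
      (fun s hs => (hd s hs.1).hasDerivWithinAt) t ⟨ht.le, le_rfl⟩
    rw [hgz t ht.le, hgz 0 le_rfl] at h
    rw [h, hz, truncFlow_zero hU hV N hR x]

/-- **Joint continuity of the truncated flow in `(x, t)`** (continuous in `t`; Lipschitz in `x`
uniformly on time strips, by Grönwall for the common Lipschitz field). [folklore] -/
theorem continuous_truncFlow_uncurry :
    Continuous fun p : PhaseSpace N × ℝ => drivenTruncSol (P.langevinDrift N) R p.1 0 p.2 := by
  obtain ⟨K, hK⟩ := P.exists_lipschitzWith_truncateField_langevinDrift hU hV N hR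
  have hLip : ∀ (x x' : PhaseSpace N) {σ : ℝ}, 0 ≤ σ →
      ‖drivenTruncSol (P.langevinDrift N) R x 0 σ - drivenTruncSol (P.langevinDrift N) R x' 0 σ‖ ≤
        ‖x - x'‖ * Real.exp (K * σ) := by
    intro x x' σ hσ
    have h := norm_forcedSolution_sub_le hK (continuous_forcing_zero x) (continuous_forcing_zero x')
      (T := σ) (δ := ‖x - x'‖) (fun t _ => by simp) σ ⟨hσ, le_rfl⟩
    exact h
  -- on each strip `univ × (-∞, T)` the flow is Lipschitz in `x` with constant `e^{K max(T,0)}`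
  have hstrip : ∀ T : ℝ, ContinuousOn
      (fun p : PhaseSpace N × ℝ => drivenTruncSol (P.langevinDrift N) R p.1 0 p.2) (univ ×ˢ Iio T) := by
    intro T
    refine continuousOn_prod_of_continuousOn_lipschitzOnWith _ (Real.exp (K * max T 0)).toNNReal
      (fun x _ => (continuous_truncFlow hU hV N hR x).continuousOn) fun σ hσ => ?_
    refine LipschitzOnWith.of_dist_le_mul fun x _ x' _ => ?_
    dsimp only
    rw [dist_eq_norm, dist_eq_norm, Real.coe_toNNReal _ (Real.exp_pos _).le]
    rcases le_or_gt 0 σ with h0 | h0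
    · refine (hLip x x' h0).trans ?_
      rw [mul_comm]
      refine mul_le_mul_of_nonneg_right (Real.exp_le_exp.2 ?_) (norm_nonneg _)
      exact mul_le_mul_of_nonneg_left ((le_max_left _ _).trans' (le_of_lt hσ)) K.coe_nonneg
    · rw [truncFlow_of_nonpos hU hV N hR x h0.le, truncFlow_of_nonpos hU hV N hR x' h0.le]
      have : (1 : ℝ) ≤ Real.exp (K * max T 0) := Real.one_le_exp (by positivity)
      nlinarith [norm_nonneg (x - x')]
  refine continuous_iff_continuousAt.2 fun p => ?_
  exact (hstrip (p.2 + 1)).continuousAt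
    ((isOpen_univ.prod isOpen_Iio).mem_nhds ⟨mem_univ _, by simp⟩)

/-- The truncated flow at a fixed time is continuous in the initial condition. [folklore] -/
theorem continuous_truncFlow_left (t : ℝ) :
    Continuous fun x : PhaseSpace N => drivenTruncSol (P.langevinDrift N) R x 0 t :=
  (continuous_truncFlow_uncurry hU hV N hR).comp (Continuous.prodMk_left t)

/-- **Parametric integrals along the truncated flow are continuous in the initial condition**:
`x ↦ ∫ₐᵇ φ(ψ_x(s)) ds` is continuous for continuous `φ`. [folklore] -/
theorem continuous_integral_comp_truncFlow {φ : PhaseSpace N → ℝ} (hφ : Continuous φ) (a b : ℝ) :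
    Continuous fun x : PhaseSpace N =>
      ∫ s in a..b, φ (drivenTruncSol (P.langevinDrift N) R x 0 s) :=
  intervalIntegral.continuous_parametric_intervalIntegral_of_continuous'
    (f := fun (x : PhaseSpace N) (s : ℝ) => φ (drivenTruncSol (P.langevinDrift N) R x 0 s))
    (hφ.comp (continuous_truncFlow_uncurry hU hV N hR)) a b

/-! ### Beyond the energy radius the truncation is invisible -/

/-- **The truncation is invisible**: if `{H ≤ h₀}` lies in the closed ball of radius `R` and
`H(x) ≤ h₀` (`P.γ = 0`), then `Y_R(ψ_x(t)) = Y(ψ_x(t))` for all `t` (energy conservation).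
[folklore] -/
theorem truncateField_truncFlow (hγ : P.γ = 0) {h₀ : ℝ}
    (hρ : ∀ z : PhaseSpace N, P.hamiltonian N z ≤ h₀ → ‖z‖ ≤ R) {x : PhaseSpace N}
    (hx : P.hamiltonian N x ≤ h₀) (t : ℝ) :
    truncateField R (P.langevinDrift N) (drivenTruncSol (P.langevinDrift N) R x 0 t) =
      P.langevinDrift N (drivenTruncSol (P.langevinDrift N) R x 0 t) :=
  truncateField_of_norm_le hR _ (hρ _ (by rw [hamiltonian_truncFlow hU hV N hR hγ]; exact hx))

/-- **The truncated flow solves the Hamiltonian system in integral form**: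
`ψ_x(t) = x + ∫₀ᵗ Y(ψ_x(s)) ds` for `t ≥ 0`, from data with `H(x) ≤ h₀`.
[cite: CuneoEckmannHairerReyBellet2018, §5.1 eq. (5.10)] -/
theorem truncFlow_eq_add_integral_langevinDrift (hγ : P.γ = 0) {h₀ : ℝ}
    (hρ : ∀ z : PhaseSpace N, P.hamiltonian N z ≤ h₀ → ‖z‖ ≤ R) {x : PhaseSpace N}
    (hx : P.hamiltonian N x ≤ h₀) {t : ℝ} (ht : 0 ≤ t) :
    drivenTruncSol (P.langevinDrift N) R x 0 t =
      x + ∫ s in (0 : ℝ)..t, P.langevinDrift N (drivenTruncSol (P.langevinDrift N) R x 0 s) := by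
  rw [truncFlow_eq_add_integral hU hV N hR x ht]
  congr 1
  exact intervalIntegral.integral_congr fun s _ => truncateField_truncFlow hU hV N hR hγ hρ hx s

/-- **The truncated flow is a classical solution of `y' = Y(y)`** on `(0, ∞)`, from data with
`H(x) ≤ h₀`. [cite: CuneoEckmannHairerReyBellet2018, §5.1 eq. (5.10)] -/
theorem hasDerivAt_truncFlow_langevinDrift (hγ : P.γ = 0) {h₀ : ℝ}
    (hρ : ∀ z : PhaseSpace N, P.hamiltonian N z ≤ h₀ → ‖z‖ ≤ R) {x : PhaseSpace N}
    (hx : P.hamiltonian N x ≤ h₀) {t : ℝ} (ht : 0 < t) :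
    HasDerivAt (drivenTruncSol (P.langevinDrift N) R x 0)
      (P.langevinDrift N (drivenTruncSol (P.langevinDrift N) R x 0 t)) t := by
  have h := hasDerivAt_truncFlow hU hV N hR x ht
  rwa [truncateField_truncFlow hU hV N hR hγ hρ hx t] at h

/-- Right derivative of the truncated flow on `[0, ∞)` as a solution of `y' = Y(y)`, from data
with `H(x) ≤ h₀`. [folklore] -/
theorem hasDerivWithinAt_truncFlow_langevinDrift (hγ : P.γ = 0) {h₀ : ℝ}
    (hρ : ∀ z : PhaseSpace N, P.hamiltonian N z ≤ h₀ → ‖z‖ ≤ R) {x : PhaseSpace N}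
    (hx : P.hamiltonian N x ≤ h₀) {t : ℝ} (ht : 0 ≤ t) :
    HasDerivWithinAt (drivenTruncSol (P.langevinDrift N) R x 0)
      (P.langevinDrift N (drivenTruncSol (P.langevinDrift N) R x 0 t)) (Ici t) t := by
  have h := hasDerivWithinAt_truncFlow hU hV N hR x ht
  rwa [truncateField_truncFlow hU hV N hR hγ hρ hx t] at h

/-- **Uniqueness**: every continuous classical solution of `y' = Y(y)` on `(0, T)` started at a
point `x` with `H(x) ≤ h₀` coincides on `[0, T]` with the truncated flow (energy conservation
keeps it in the ball of radius `R`, where `Y = Y_R` is Lipschitz; Grönwall). [folklore] -/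
theorem eqOn_truncFlow_of_hasDerivAt (hγ : P.γ = 0) {h₀ : ℝ}
    (hρ : ∀ z : PhaseSpace N, P.hamiltonian N z ≤ h₀ → ‖z‖ ≤ R) {x : PhaseSpace N}
    (hx : P.hamiltonian N x ≤ h₀) {y : ℝ → PhaseSpace N} (hyc : Continuous y) (hy0 : y 0 = x)
    {T : ℝ} (hy : ∀ t ∈ Ioo 0 T, HasDerivAt y (P.langevinDrift N (y t)) t) :
    EqOn y (drivenTruncSol (P.langevinDrift N) R x 0) (Icc 0 T) := by
  subst hy0
  obtain ⟨K, hK⟩ := P.exists_lipschitzWith_truncateField_langevinDrift hU hV N hR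
  have hU1 : ∀ i, ContDiff ℝ 1 (P.U i) := fun i => (hU i).of_le (by norm_num)
  have hV1 : ∀ i, ContDiff ℝ 1 (P.V i) := fun i => (hV i).of_le (by norm_num)
  have hYc : Continuous (P.langevinDrift N) := (P.contDiff_one_langevinDrift hU hV N).continuous
  -- energy conservation keeps `y` in the ball of radius `R` on `[0, T]`
  have hE : ∀ t ∈ Icc 0 T, P.hamiltonian N (y t) = P.hamiltonian N (y 0) :=
    P.hamiltonian_eq_of_hasDerivAt_langevinDrift hU1 hV1 hγ hyc.continuousOn hy
  have hball : ∀ t ∈ Icc 0 T, ‖y t‖ ≤ R := fun t ht => hρ _ (by rw [hE t ht]; exact hx)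
  -- hence `y` solves the truncated integral equation
  have hsol : IsIntegralSolutionOn (P.langevinDrift N) (fun _ => y 0) y T :=
    isIntegralSolutionOn_of_hasDerivAt_Ioo hYc hyc hy
  have hsolR : IsIntegralSolutionOn (truncateField R (P.langevinDrift N))
      (fun t => y 0 + (0 : ℝ → PhaseSpace N) t) y T := by
    intro t ht
    rw [hsol t ht]
    simp only [Pi.zero_apply, add_zero]
    congr 1
    refine intervalIntegral.integral_congr fun s hs => ?_
    rw [uIcc_of_le ht.1] at hs
    exact (truncateField_of_norm_le hR _ (hball s ⟨hs.1, hs.2.trans ht.2⟩)).symm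
  exact hsolR.eqOn_forcedSolution hK (continuous_forcing_zero (y 0)) hyc

end TruncFlow

end SiteChain

end Literature.MathematicalPhysics.KineticTheory.HeatConduction
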